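import Mathlib
import HarnessLib
import Summits.AtomisticToContinuum.FouriersLaw.Theses.JunctionLocality
import Summits.AtomisticToContinuum.FouriersLaw.Theorems.JunctionLocalitySuperadditiveResistanceKuboDirichlet

/-!
# Kubo–Onsager for the γ-thermostatted pinned chain, III: Green identities at cutoff level

Helper file (`--supports` stmt-AtomisticToContinuum-11748) for stub `stub_kuboOnsager` of the line
`floating-probe-bypass-laplacian` (crux `JunctionLocality.SuperadditiveResistance`). Setting as in part II: pinned
chain, `T > 0`, weights `B`, friction `c`, pairs `(f, k_f)` with `σ X_H f + c S_B f = −k_f` pointwise.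

* `polar_level` — two pairs with the SAME `σ`:
  `∫ χ_n (h k_f + f k_h) ρ = c T Σ_i B_i (2 ∫ χ_n ∂_{p_i}f ∂_{p_i}h ρ + ∫ (h ∂_{p_i}f + f ∂_{p_i}h) ∂_{p_i}χ_n ρ)`;
* `cross_level` — a `σ`-pair `(f, k_f)` and a `(−σ)`-pair `(h, k_h)` (forward against backward):
  `∫ χ_n h k_f ρ − ∫ χ_n f k_h ρ = c T Σ_i B_i ∫ (h ∂_{p_i}f − f ∂_{p_i}h) ∂_{p_i}χ_n ρ`.
Both are exact consequences of `integral_chi_liouville_antisymm` and `integral_chi_mul_bathOp` (part I); part IV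
removes the cutoff. References: folklore (Green's identities for `σX_H + cS_B` in `L²(e^{-H/T} dx)`).
-/

noncomputable section

open MeasureTheory Filter Topology ProbabilityTheory
open scoped ContDiff NNReal ENNReal
open Literature.MathematicalPhysics.KineticTheory.HeatConduction
open Summit.AtomisticToContinuum.FouriersLaw.Theorems.SuperadditiveResistance.DeviceLiouville

namespace Summit.AtomisticToContinuum.FouriersLaw.Theorems.SuperadditiveResistance.Kubo

section Green

variable {ω₂ lam β γ : ℝ} {L : ℕ}

set_option hygiene false in
/-- Local shorthand for the pinned chain of this section. -/
local notation "𝐏" => pinnedChain ω₂ lam β γ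

/-- Continuity of the source of a pair: `k = −(σ X_H f + c S_B f)` is continuous for `f ∈ C²`. [folklore] -/
theorem continuous_source (B : Fin L → ℝ) (T σ c : ℝ) {f k : PhaseSpace L → ℝ} (hf : ContDiff ℝ 2 f)
    (hpde : ∀ x, σ * liouvilleOp 𝐏 L f x + c * bathOp L B T f x = -k x) :
    Continuous k := by
  have hH1 : ContDiff ℝ 1 ((𝐏).hamiltonian L) :=
    ((𝐏).contDiff_hamiltonian (pinnedChain_contDiff_U ω₂ lam β γ)
      (pinnedChain_contDiff_V ω₂ lam β γ) L).of_le (by norm_cast)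
  have hf1 : ContDiff ℝ 1 f := hf.of_le (by norm_cast)
  have hQc : ∀ j, Continuous (partialQ j f) := fun j => continuous_partialQ hf1 one_ne_zero j
  have hPc : ∀ j, Continuous (partialP j f) := fun j => continuous_partialP hf1 one_ne_zero j
  have hPPc : ∀ j, Continuous (partialP j (partialP j f)) := fun j =>
    continuous_partialP (contDiff_partialP hf (by norm_num) j) one_ne_zero j
  have hWc : ∀ j, Continuous (partialQ j ((𝐏).hamiltonian L)) := fun j =>
    (𝐏).continuous_partialQ_hamiltonian hH1 j
  have hk : k = fun x => -(σ * liouvilleOp 𝐏 L f x + c * bathOp L B T f x) := by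
    funext x; have := hpde x; linarith
  rw [hk]
  unfold liouvilleOp bathOp
  fun_prop

/-- Continuity of `X_H f` for `f ∈ C²` (pinned chain). [folklore] -/
theorem continuous_liouvilleOp (L : ℕ) {f : PhaseSpace L → ℝ} (hf : ContDiff ℝ 2 f) :
    Continuous (liouvilleOp 𝐏 L f) := by
  have hH1 : ContDiff ℝ 1 ((𝐏).hamiltonian L) :=
    ((𝐏).contDiff_hamiltonian (pinnedChain_contDiff_U ω₂ lam β γ)
      (pinnedChain_contDiff_V ω₂ lam β γ) L).of_le (by norm_cast)
  have hf1 : ContDiff ℝ 1 f := hf.of_le (by norm_cast)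
  have := fun j => continuous_partialQ hf1 one_ne_zero j
  have := fun j => continuous_partialP hf1 one_ne_zero j
  have := fun j => (𝐏).continuous_partialQ_hamiltonian hH1 j
  unfold liouvilleOp; fun_prop

/-- Continuity of `S_B f` for `f ∈ C²`. [folklore] -/
theorem continuous_bathOp (L : ℕ) (B : Fin L → ℝ) (T : ℝ) {f : PhaseSpace L → ℝ} (hf : ContDiff ℝ 2 f) :
    Continuous (bathOp L B T f) := by
  have hf1 : ContDiff ℝ 1 f := hf.of_le (by norm_cast)
  have := fun j => continuous_partialP hf1 one_ne_zero j
  have := fun j => continuous_partialP (contDiff_partialP hf (by norm_num) j) one_ne_zero j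
  unfold bathOp; fun_prop

/-- Bookkeeping: `Σ_i B_i (I_i + U_i) + Σ_i B_i (I_i + V_i) = Σ_i B_i (2 I_i + (U_i + V_i))`. [folklore] -/
theorem sum_polar_aux (B I U V : Fin L → ℝ) :
    (∑ i, B i * (I i + U i)) + ∑ i, B i * (I i + V i) = ∑ i, B i * (2 * I i + (U i + V i)) := by
  rw [← Finset.sum_add_distrib]
  exact Finset.sum_congr rfl fun i _ => by ring

/-- Bookkeeping: `Σ_i B_i (I_i + U_i) − Σ_i B_i (I_i + V_i) = Σ_i B_i (U_i − V_i)`. [folklore] -/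
theorem sum_cross_aux (B I U V : Fin L → ℝ) :
    (∑ i, B i * (I i + U i)) - ∑ i, B i * (I i + V i) = ∑ i, B i * (U i - V i) := by
  rw [← Finset.sum_sub_distrib]
  exact Finset.sum_congr rfl fun i _ => by ring

/-- **Polarised Green identity at cutoff level** (two pairs with the same `σ`):
`∫ χ_n (h k_f + f k_h) ρ = c T Σ_i B_i (2 ∫ χ_n ∂_{p_i}f ∂_{p_i}h ρ + ∫ (h ∂_{p_i}f + f ∂_{p_i}h) ∂_{p_i}χ_n ρ)`. [folklore] -/
theorem polar_level (hω : 0 < ω₂) (hl : 0 ≤ lam) (hβ : 0 ≤ β) (L : ℕ) {T : ℝ} (hT : 0 < T)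
    (B : Fin L → ℝ) (σ c : ℝ) {f kf h kh : PhaseSpace L → ℝ} (hf : ContDiff ℝ 2 f) (hh : ContDiff ℝ 2 h)
    (hpf : ∀ x, σ * liouvilleOp 𝐏 L f x + c * bathOp L B T f x = -kf x)
    (hph : ∀ x, σ * liouvilleOp 𝐏 L h x + c * bathOp L B T h x = -kh x) (n : ℕ) :
    ∫ x, chi 𝐏 L n x * (h x * kf x + f x * kh x) * (𝐏).gibbsDensity L T x =
      c * T * ∑ i, B i * (2 * (∫ x, chi 𝐏 L n x * partialP i f x * partialP i h x * (𝐏).gibbsDensity L T x) +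
        ∫ x, (h x * partialP i f x + f x * partialP i h x) * partialP i (chi 𝐏 L n) x *
          (𝐏).gibbsDensity L T x) := by
  have hHs : ContDiff ℝ ∞ ((𝐏).hamiltonian L) :=
    (𝐏).contDiff_hamiltonian (pinnedChain_contDiff_U ω₂ lam β γ) (pinnedChain_contDiff_V ω₂ lam β γ) L
  have hχs : ContDiff ℝ ∞ (chi 𝐏 L n) := contDiff_chi hHs n
  have hχ1 : ContDiff ℝ 1 (chi 𝐏 L n) := hχs.of_le (by norm_cast)
  have hχcont : Continuous (chi 𝐏 L n) := hχs.continuous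
  have hχc : HasCompactSupport (chi 𝐏 L n) := hasCompactSupport_chi hω hl hβ γ L n
  have hχd : Differentiable ℝ (chi 𝐏 L n) := hχ1.differentiable one_ne_zero
  have hdχc : ∀ j, Continuous (partialP j (chi 𝐏 L n)) := fun j => continuous_partialP hχ1 one_ne_zero j
  have hdχs : ∀ j, HasCompactSupport (partialP j (chi 𝐏 L n)) := fun j => hasCompactSupport_partialP hχd hχc j
  have hf1 : ContDiff ℝ 1 f := hf.of_le (by norm_cast)
  have hh1 : ContDiff ℝ 1 h := hh.of_le (by norm_cast)
  have hfc : Continuous f := hf.continuous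
  have hhc : Continuous h := hh.continuous
  have hdfc : ∀ j, Continuous (partialP j f) := fun j => continuous_partialP hf1 one_ne_zero j
  have hdhc : ∀ j, Continuous (partialP j h) := fun j => continuous_partialP hh1 one_ne_zero j
  have hρc : Continuous ((𝐏).gibbsDensity L T) := pinnedChain_continuous_gibbsDensity ω₂ lam β γ L T
  have hXfc : Continuous (liouvilleOp 𝐏 L f) := continuous_liouvilleOp L hf
  have hXhc : Continuous (liouvilleOp 𝐏 L h) := continuous_liouvilleOp L hh
  have hSfc : Continuous (bathOp L B T f) := continuous_bathOp L B T hf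
  have hShc : Continuous (bathOp L B T h) := continuous_bathOp L B T hh
  -- named integrals
  set W : ℝ := ∫ x, chi 𝐏 L n x * (h x * liouvilleOp 𝐏 L f x + f x * liouvilleOp 𝐏 L h x) *
    (𝐏).gibbsDensity L T x with hW
  set S1 : ℝ := ∫ x, chi 𝐏 L n x * h x * bathOp L B T f x * (𝐏).gibbsDensity L T x with hS1
  set S2 : ℝ := ∫ x, chi 𝐏 L n x * f x * bathOp L B T h x * (𝐏).gibbsDensity L T x with hS2
  set I : Fin L → ℝ := fun i => ∫ x, chi 𝐏 L n x * partialP i f x * partialP i h x *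
    (𝐏).gibbsDensity L T x with hI
  set U : Fin L → ℝ := fun i => ∫ x, h x * partialP i (chi 𝐏 L n) x * partialP i f x *
    (𝐏).gibbsDensity L T x with hU
  set V : Fin L → ℝ := fun i => ∫ x, f x * partialP i (chi 𝐏 L n) x * partialP i h x *
    (𝐏).gibbsDensity L T x with hV
  -- the three exact ingredients
  have hA : W = 0 := integral_chi_liouville_antisymm hω hl hβ γ L hT.ne' hh hf n
  have hB1 : S1 = -T * ∑ i, B i * (I i + U i) := by
    have e := integral_chi_mul_bathOp hω hl hβ γ L B hT.ne' hh hf n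
    have hsym : ∀ i, (fun x => chi 𝐏 L n x * partialP i h x * partialP i f x * (𝐏).gibbsDensity L T x) =
        fun x => chi 𝐏 L n x * partialP i f x * partialP i h x * (𝐏).gibbsDensity L T x := by
      intro i; funext x; ring
    simp only [hsym] at e
    exact e
  have hB2 : S2 = -T * ∑ i, B i * (I i + V i) := integral_chi_mul_bathOp hω hl hβ γ L B hT.ne' hf hh n
  -- integrate the pointwise equations
  have hIX : Integrable fun x => chi 𝐏 L n x * (h x * liouvilleOp 𝐏 L f x + f x * liouvilleOp 𝐏 L h x) *
      (𝐏).gibbsDensity L T x :=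
    Continuous.integrable_of_hasCompactSupport (by fun_prop) (hχc.mul_right.mul_right)
  have hIS1 : Integrable fun x => chi 𝐏 L n x * h x * bathOp L B T f x * (𝐏).gibbsDensity L T x :=
    Continuous.integrable_of_hasCompactSupport (by fun_prop) (hχc.mul_right.mul_right.mul_right)
  have hIS2 : Integrable fun x => chi 𝐏 L n x * f x * bathOp L B T h x * (𝐏).gibbsDensity L T x :=
    Continuous.integrable_of_hasCompactSupport (by fun_prop) (hχc.mul_right.mul_right.mul_right)
  have hpt : (fun x => chi 𝐏 L n x * (h x * kf x + f x * kh x) * (𝐏).gibbsDensity L T x) = fun x =>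
      -(σ * (chi 𝐏 L n x * (h x * liouvilleOp 𝐏 L f x + f x * liouvilleOp 𝐏 L h x) * (𝐏).gibbsDensity L T x) +
        (c * (chi 𝐏 L n x * h x * bathOp L B T f x * (𝐏).gibbsDensity L T x) +
         c * (chi 𝐏 L n x * f x * bathOp L B T h x * (𝐏).gibbsDensity L T x))) := by
    funext x
    have e1 : kf x = -(σ * liouvilleOp 𝐏 L f x + c * bathOp L B T f x) := by have := hpf x; linarith
    have e2 : kh x = -(σ * liouvilleOp 𝐏 L h x + c * bathOp L B T h x) := by have := hph x; linarith
    rw [e1, e2]; ring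
  have hIS12 : Integrable fun x => c * (chi 𝐏 L n x * h x * bathOp L B T f x * (𝐏).gibbsDensity L T x) +
      c * (chi 𝐏 L n x * f x * bathOp L B T h x * (𝐏).gibbsDensity L T x) :=
    (hIS1.const_mul c).add (hIS2.const_mul c)
  have hL : ∫ x, chi 𝐏 L n x * (h x * kf x + f x * kh x) * (𝐏).gibbsDensity L T x = -(σ * W + (c * S1 + c * S2)) := by
    rw [hpt, integral_neg, integral_add (hIX.const_mul σ) hIS12,
      integral_add (hIS1.const_mul c) (hIS2.const_mul c), integral_const_mul, integral_const_mul,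
      integral_const_mul]
  -- combine the two cutoff-gradient integrals into one
  have hI1 : ∀ i, Integrable fun x => h x * partialP i (chi 𝐏 L n) x * partialP i f x * (𝐏).gibbsDensity L T x :=
    fun i => Continuous.integrable_of_hasCompactSupport (by fun_prop) (((hdχs i).mul_left).mul_right.mul_right)
  have hI2 : ∀ i, Integrable fun x => f x * partialP i (chi 𝐏 L n) x * partialP i h x * (𝐏).gibbsDensity L T x :=
    fun i => Continuous.integrable_of_hasCompactSupport (by fun_prop) (((hdχs i).mul_left).mul_right.mul_right)
  have hcomb : ∀ i, U i + V i =
      ∫ x, (h x * partialP i f x + f x * partialP i h x) * partialP i (chi 𝐏 L n) x * (𝐏).gibbsDensity L T x := by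
    intro i
    simp only [hU, hV]
    rw [← integral_add (hI1 i) (hI2 i)]
    refine integral_congr_ae (ae_of_all _ fun x => ?_)
    ring
  rw [hL, hA, hB1, hB2]
  have hsum := sum_polar_aux B I U V
  rw [show ∑ i, B i * (2 * I i + ∫ x, (h x * partialP i f x + f x * partialP i h x) *
      partialP i (chi 𝐏 L n) x * (𝐏).gibbsDensity L T x) = ∑ i, B i * (2 * I i + (U i + V i)) from
    Finset.sum_congr rfl fun i _ => by rw [hcomb i]]
  rw [← hsum]
  ring

/-- **Cross Green identity at cutoff level** (a `σ`-pair and a `(−σ)`-pair — forward against backward):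
`∫ χ_n h k_f ρ − ∫ χ_n f k_h ρ = c T Σ_i B_i ∫ (h ∂_{p_i}f − f ∂_{p_i}h) ∂_{p_i}χ_n ρ`. [folklore] -/
theorem cross_level (hω : 0 < ω₂) (hl : 0 ≤ lam) (hβ : 0 ≤ β) (L : ℕ) {T : ℝ} (hT : 0 < T)
    (B : Fin L → ℝ) (σ c : ℝ) {f kf h kh : PhaseSpace L → ℝ} (hf : ContDiff ℝ 2 f) (hh : ContDiff ℝ 2 h)
    (hpf : ∀ x, σ * liouvilleOp 𝐏 L f x + c * bathOp L B T f x = -kf x)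
    (hph : ∀ x, -σ * liouvilleOp 𝐏 L h x + c * bathOp L B T h x = -kh x) (n : ℕ) :
    (∫ x, chi 𝐏 L n x * h x * kf x * (𝐏).gibbsDensity L T x) -
      (∫ x, chi 𝐏 L n x * f x * kh x * (𝐏).gibbsDensity L T x) =
      c * T * ∑ i, B i * ∫ x, (h x * partialP i f x - f x * partialP i h x) *
        partialP i (chi 𝐏 L n) x * (𝐏).gibbsDensity L T x := by
  have hHs : ContDiff ℝ ∞ ((𝐏).hamiltonian L) :=
    (𝐏).contDiff_hamiltonian (pinnedChain_contDiff_U ω₂ lam β γ) (pinnedChain_contDiff_V ω₂ lam β γ) L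
  have hχs : ContDiff ℝ ∞ (chi 𝐏 L n) := contDiff_chi hHs n
  have hχ1 : ContDiff ℝ 1 (chi 𝐏 L n) := hχs.of_le (by norm_cast)
  have hχcont : Continuous (chi 𝐏 L n) := hχs.continuous
  have hχc : HasCompactSupport (chi 𝐏 L n) := hasCompactSupport_chi hω hl hβ γ L n
  have hχd : Differentiable ℝ (chi 𝐏 L n) := hχ1.differentiable one_ne_zero
  have hdχc : ∀ j, Continuous (partialP j (chi 𝐏 L n)) := fun j => continuous_partialP hχ1 one_ne_zero j
  have hdχs : ∀ j, HasCompactSupport (partialP j (chi 𝐏 L n)) := fun j => hasCompactSupport_partialP hχd hχc j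
  have hf1 : ContDiff ℝ 1 f := hf.of_le (by norm_cast)
  have hh1 : ContDiff ℝ 1 h := hh.of_le (by norm_cast)
  have hfc : Continuous f := hf.continuous
  have hhc : Continuous h := hh.continuous
  have hdfc : ∀ j, Continuous (partialP j f) := fun j => continuous_partialP hf1 one_ne_zero j
  have hdhc : ∀ j, Continuous (partialP j h) := fun j => continuous_partialP hh1 one_ne_zero j
  have hρc : Continuous ((𝐏).gibbsDensity L T) := pinnedChain_continuous_gibbsDensity ω₂ lam β γ L T
  have hXfc : Continuous (liouvilleOp 𝐏 L f) := continuous_liouvilleOp L hf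
  have hXhc : Continuous (liouvilleOp 𝐏 L h) := continuous_liouvilleOp L hh
  have hSfc : Continuous (bathOp L B T f) := continuous_bathOp L B T hf
  have hShc : Continuous (bathOp L B T h) := continuous_bathOp L B T hh
  -- named integrals
  set Wa : ℝ := ∫ x, chi 𝐏 L n x * h x * liouvilleOp 𝐏 L f x * (𝐏).gibbsDensity L T x with hWa
  set Wb : ℝ := ∫ x, chi 𝐏 L n x * f x * liouvilleOp 𝐏 L h x * (𝐏).gibbsDensity L T x with hWb
  set S1 : ℝ := ∫ x, chi 𝐏 L n x * h x * bathOp L B T f x * (𝐏).gibbsDensity L T x with hS1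
  set S2 : ℝ := ∫ x, chi 𝐏 L n x * f x * bathOp L B T h x * (𝐏).gibbsDensity L T x with hS2
  set I : Fin L → ℝ := fun i => ∫ x, chi 𝐏 L n x * partialP i f x * partialP i h x *
    (𝐏).gibbsDensity L T x with hI
  set U : Fin L → ℝ := fun i => ∫ x, h x * partialP i (chi 𝐏 L n) x * partialP i f x *
    (𝐏).gibbsDensity L T x with hU
  set V : Fin L → ℝ := fun i => ∫ x, f x * partialP i (chi 𝐏 L n) x * partialP i h x *
    (𝐏).gibbsDensity L T x with hV
  have hIXa : Integrable fun x => chi 𝐏 L n x * h x * liouvilleOp 𝐏 L f x * (𝐏).gibbsDensity L T x :=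
    Continuous.integrable_of_hasCompactSupport (by fun_prop) (hχc.mul_right.mul_right.mul_right)
  have hIXb : Integrable fun x => chi 𝐏 L n x * f x * liouvilleOp 𝐏 L h x * (𝐏).gibbsDensity L T x :=
    Continuous.integrable_of_hasCompactSupport (by fun_prop) (hχc.mul_right.mul_right.mul_right)
  have hIS1 : Integrable fun x => chi 𝐏 L n x * h x * bathOp L B T f x * (𝐏).gibbsDensity L T x :=
    Continuous.integrable_of_hasCompactSupport (by fun_prop) (hχc.mul_right.mul_right.mul_right)
  have hIS2 : Integrable fun x => chi 𝐏 L n x * f x * bathOp L B T h x * (𝐏).gibbsDensity L T x :=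
    Continuous.integrable_of_hasCompactSupport (by fun_prop) (hχc.mul_right.mul_right.mul_right)
  -- antisymmetry: Wa + Wb = 0
  have hA : Wa + Wb = 0 := by
    have e := integral_chi_liouville_antisymm hω hl hβ γ L hT.ne' hh hf n
    have hsplit : (fun x => chi 𝐏 L n x * (h x * liouvilleOp 𝐏 L f x + f x * liouvilleOp 𝐏 L h x) *
        (𝐏).gibbsDensity L T x) = fun x => chi 𝐏 L n x * h x * liouvilleOp 𝐏 L f x * (𝐏).gibbsDensity L T x +
          chi 𝐏 L n x * f x * liouvilleOp 𝐏 L h x * (𝐏).gibbsDensity L T x := by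
      funext x; ring
    rw [hsplit, integral_add hIXa hIXb] at e
    exact e
  have hB1 : S1 = -T * ∑ i, B i * (I i + U i) := by
    have e := integral_chi_mul_bathOp hω hl hβ γ L B hT.ne' hh hf n
    have hsym : ∀ i, (fun x => chi 𝐏 L n x * partialP i h x * partialP i f x * (𝐏).gibbsDensity L T x) =
        fun x => chi 𝐏 L n x * partialP i f x * partialP i h x * (𝐏).gibbsDensity L T x := by
      intro i; funext x; ring
    simp only [hsym] at e
    exact e
  have hB2 : S2 = -T * ∑ i, B i * (I i + V i) := integral_chi_mul_bathOp hω hl hβ γ L B hT.ne' hf hh n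
  have hpt1 : (fun x => chi 𝐏 L n x * h x * kf x * (𝐏).gibbsDensity L T x) = fun x =>
      -(σ * (chi 𝐏 L n x * h x * liouvilleOp 𝐏 L f x * (𝐏).gibbsDensity L T x) +
        c * (chi 𝐏 L n x * h x * bathOp L B T f x * (𝐏).gibbsDensity L T x)) := by
    funext x
    have e1 : kf x = -(σ * liouvilleOp 𝐏 L f x + c * bathOp L B T f x) := by have := hpf x; linarith
    rw [e1]; ring
  have hpt2 : (fun x => chi 𝐏 L n x * f x * kh x * (𝐏).gibbsDensity L T x) = fun x =>
      -(-σ * (chi 𝐏 L n x * f x * liouvilleOp 𝐏 L h x * (𝐏).gibbsDensity L T x) +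
        c * (chi 𝐏 L n x * f x * bathOp L B T h x * (𝐏).gibbsDensity L T x)) := by
    funext x
    have e2 : kh x = -(-σ * liouvilleOp 𝐏 L h x + c * bathOp L B T h x) := by have := hph x; linarith
    rw [e2]; ring
  have hL1 : ∫ x, chi 𝐏 L n x * h x * kf x * (𝐏).gibbsDensity L T x = -(σ * Wa + c * S1) := by
    rw [hpt1, integral_neg, integral_add (hIXa.const_mul σ) (hIS1.const_mul c), integral_const_mul,
      integral_const_mul]
  have hL2 : ∫ x, chi 𝐏 L n x * f x * kh x * (𝐏).gibbsDensity L T x = -(-σ * Wb + c * S2) := by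
    rw [hpt2, integral_neg, integral_add (hIXb.const_mul (-σ)) (hIS2.const_mul c), integral_const_mul,
      integral_const_mul]
  have hI1 : ∀ i, Integrable fun x => h x * partialP i (chi 𝐏 L n) x * partialP i f x * (𝐏).gibbsDensity L T x :=
    fun i => Continuous.integrable_of_hasCompactSupport (by fun_prop) (((hdχs i).mul_left).mul_right.mul_right)
  have hI2 : ∀ i, Integrable fun x => f x * partialP i (chi 𝐏 L n) x * partialP i h x * (𝐏).gibbsDensity L T x :=
    fun i => Continuous.integrable_of_hasCompactSupport (by fun_prop) (((hdχs i).mul_left).mul_right.mul_right)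
  have hcomb : ∀ i, U i - V i =
      ∫ x, (h x * partialP i f x - f x * partialP i h x) * partialP i (chi 𝐏 L n) x * (𝐏).gibbsDensity L T x := by
    intro i
    simp only [hU, hV]
    rw [← integral_sub (hI1 i) (hI2 i)]
    refine integral_congr_ae (ae_of_all _ fun x => ?_)
    ring
  rw [hL1, hL2, hB1, hB2]
  have hsum := sum_cross_aux B I U V
  rw [show ∑ i, B i * ∫ x, (h x * partialP i f x - f x * partialP i h x) *
      partialP i (chi 𝐏 L n) x * (𝐏).gibbsDensity L T x = ∑ i, B i * (U i - V i) from
    Finset.sum_congr rfl fun i _ => by rw [hcomb i]]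
  rw [← hsum]
  have hWb : Wb = -Wa := by linarith
  rw [hWb]
  ring

end Green

/-- Registered helper sub-goal `helper_kuboCrossLevel` of stub `stub_kuboOnsager` (= `cross_level` in stub form; line
`floating-probe-bypass-laplacian`, crux stmt-AtomisticToContinuum-11748). [folklore] -/
theorem helper_kuboCrossLevel : ∀ {ω₂ lam β γ : ℝ}, 0 < ω₂ → 0 ≤ lam → 0 ≤ β → ∀ (L : ℕ) {T : ℝ}, 0 < T → ∀ (B : Fin L → ℝ) (σ c : ℝ) {f kf h kh : PhaseSpace L → ℝ}, ContDiff ℝ 2 f → ContDiff ℝ 2 h → (∀ x, σ * liouvilleOp (pinnedChain ω₂ lam β γ) L f x + c * bathOp L B T f x = -kf x) → (∀ x, -σ * liouvilleOp (pinnedChain ω₂ lam β γ) L h x + c * bathOp L B T h x = -kh x) → ∀ (n : ℕ), (∫ x, chi (pinnedChain ω₂ lam β γ) L n x * h x * kf x * (pinnedChain ω₂ lam β γ).gibbsDensity L T x) - (∫ x, chi (pinnedChain ω₂ lam β γ) L n x * f x * kh x * (pinnedChain ω₂ lam β γ).gibbsDensity L T x) = c * T * ∑ i, B i * ∫ x,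 (h x * partialP i f x - f x * partialP i h x) * partialP i (chi (pinnedChain ω₂ lam β γ) L n) x * (pinnedChain ω₂ lam β γ).gibbsDensity L T x :=
  @cross_level

end Summit.AtomisticToContinuum.FouriersLaw.Theorems.SuperadditiveResistance.Kubo

end
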